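import Summits.NavierStokesRegularity.NavierStokesRegularity.Theorems.FilamentSkeletonRssCoreLinearInvertibilityOddArnoldToolsA
import Summits.NavierStokesRegularity.NavierStokesRegularity.Theorems.FilamentSkeletonRssCoreLinearInvertibilityOddArnoldToolsB
import Summits.NavierStokesRegularity.NavierStokesRegularity.Theorems.FilamentSkeletonRssCoreLinearInvertibilityOddArnoldToolsC
import Literature.Analysis.FluidPDE.GaussianVortexKernelRadial
import Literature.Analysis.FluidPDE.ArnoldCoercivityGaussianVortex

/-!
# Crux `CoreLinearInvertibility` (stmt-NavierStokesRegularity-17973), line `Sketch`, stub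
# `stub_oddSymmetrizerBoundedBelow` — core: the Gallay–Šverák coercivity of Arnold's quadratic form at
# the Gaussian vortex (named fact, vendored inline) and the `L²(Φ⁻¹)` bound on the symmetrized density

The registered stub `stub_oddSymmetrizerBoundedBelow` of the skeleton
`Cruxes/CoreLinearInvertibility/Lines/Sketch.lean` asks, for `λ ∈ (0,1)`, for a constant `C_V` with
`‖w‖_{X_λ} ≤ C_V ‖w + u_w‖_{X_λ}` for every odd `C²_c` vorticity `w` with zero first moments, where
`u_w = Φ(|x|) ψ_w`, `ψ_w = N ∗ w`, `N = (2π)⁻¹ log|·|`, `Φ = kerWeight` (`Φ(r) = (r²/4)/(e^{r²/4} − 1)`),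
`X_λ = L²(G_λ⁻¹ dx)`.  Writing `K̃a = −Φ ψ_a`, the map `w ↦ w + u_w = (I − K̃)w` is the forward
symmetrizer, and `⟨(I − K̃)a, a⟩_{L²(Φ⁻¹)} = ∫ Φ⁻¹a² + ∫ a ψ_a = 2J(a)` is (twice) ARNOLD'S QUADRATIC FORM
of Gallay–Šverák at the Gaussian vortex, whose weight is exactly `𝒜 = 1/Φ` (their §4, Lemma 4.1:
`𝒜(x) = 4|x|⁻²(e^{|x|²/4} − 1)`).  Its coercivity on odd densities with zero first moments is IN PRINT:
Th. Gallay, V. Šverák, *Arnold's variational principle and its application to the stability of planar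
vortices*, arXiv:2110.13739 (Analysis & PDE 17 (2024) 681–722), Theorem 2.5 with Remark 2.7 — vendored
here INLINE as the named fact `GallaySverak2021_thm25_gaussian` (a `[cite]`d closed `def … : Prop`,
relocated by the gate to `Literature/Analysis/FluidPDE/ArnoldCoercivityGaussianVortex.lean`).

Proved here from the fact (tools `…OddArnoldToolsA/B/C`):

* `arnold_kerNorm_corrected_le`: for a continuous odd Gaussian-class `g₀` with `∫ x_j g₀ = 0` and
  `F = (I − K̃)g₀`, `‖g₀‖_{L²(Φ⁻¹)} ≤ γ⁻¹ ‖F‖_{L²(Φ⁻¹)}` (`γ‖g₀‖² ≤ 2J(g₀) = ⟨F, g₀⟩ ≤ ‖F‖‖g₀‖`);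
* `arnold_kerNorm_le_of_symmetrized` (registered tools stub `stub_oddArnoldCore`): if `f, g` are
  continuous of Gaussian class, `g` odd, `∫ x_j g = −∫ x_j f` and `(I − K̃)g = K̃ f`, then
  `‖g‖_{L²(Φ⁻¹)} ≤ B ‖f‖_{X_λ}` — correct the moments of `g` with the odd Gaussian-class basis `e_j`
  (`∫ x_i e_j = δ_ij`), apply the fact to `g₀ = g + Σ m_j(f) e_j`, and bound
  `‖(I − K̃)g₀‖ ≤ ‖Φψ_f‖ + Σ|m_j(f)| ‖(I − K̃)e_j‖` by `‖Φ ψ_f‖_{L²(Φ⁻¹)} ≤ K‖f‖_{X_λ}`,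
  `|m_j(f)| ≤ M‖f‖_{X_λ}` (weighted Cauchy–Schwarz and Minkowski throughout).

The final reduction `stub_oddSymmetrizerBoundedBelowOfArnold : Literature.Analysis.FluidPDE.GallaySverak2021_thm25_gaussian → <stub body>`
(`f = w + u_w`, `g = −u_w`, `‖w‖_{X_λ} ≤ ‖f‖_{X_λ} + √(4π/(λ(1−λ))) ‖g‖_{L²(Φ⁻¹)}`) is the file
`…OddArnold.lean`.

## References

* Th. Gallay, V. Šverák, *Arnold's variational principle and its application to the stability of
  planar vortices*, arXiv:2110.13739 = Analysis & PDE 17 (2024) 681–722: §1.2 (iv) (energy `E`, stream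
  function `ψ = (2π)⁻¹ log|·| ∗ ω`), §2 Hypotheses 2.1, Prop. 2.2, the spaces `X ⊃ X₀ ⊃ X₁`, `X_rs`,
  the form `J`, Thm. 2.5, Rem. 2.7 (`𝒳₁`: moments `∫ x_j ω = 0` when `β > 4`), §4.1 Lemma 4.1 and the
  proof of Thm. 4.5 (the Gaussian case, `𝒜 = 4|x|⁻²(e^{|x|²/4} − 1)`). [GallaySverak2021]
* Th. Gallay, C. E. Wayne, J. Math. Fluid Mech. 9 (2007), proof of Prop. 3.1 (the weight `h = Φ`);
  Th. Gallay, Y. Maekawa, arXiv:1610.08384, Lemma 2.7 (`ker Λ`, the role of `Φ = G/(2Ω)`).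
-/

set_option linter.dupNamespace false

noncomputable section

namespace Summit.NavierStokesRegularity.NavierStokesRegularity.Theorems

open Set Function Filter MeasureTheory Topology Metric
open Literature.Analysis.FluidPDE
open scoped InnerProductSpace

/-- **From the coercivity to a norm bound on a corrected density.** If the Gallay–Šverák fact
holds with constant `γ`, then for every continuous odd Gaussian-class `g₀` with `∫ x_j g₀ = 0` and
every measurable Gaussian-class `F` with `F = g₀ + Φ ψ_{g₀} = (I − K̃) g₀` pointwise,
`‖g₀‖_{L²(Φ⁻¹)} ≤ γ⁻¹ ‖F‖_{L²(Φ⁻¹)}`: indeed `∫ Φ⁻¹ g₀² + ∫ g₀ ψ_{g₀} = ∫ Φ⁻¹ g₀ F ≤ ‖g₀‖ ‖F‖`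
(weighted Cauchy–Schwarz). [folklore] -/
theorem arnold_kerNorm_corrected_le (hGS : Literature.Analysis.FluidPDE.GallaySverak2021_thm25_gaussian) :
    ∃ A : ℝ, 0 ≤ A ∧ ∀ g₀ : EuclideanSpace ℝ (Fin 2) → ℝ, Continuous g₀ →
      (∃ (C : ℝ) (N : ℕ), ∀ x, |g₀ x| ≤ C * (1 + ‖x‖) ^ N * Real.exp (-(‖x‖ ^ 2 / 4))) →
      (∀ x, g₀ (-x) = -g₀ x) → ∫ x, x 0 * g₀ x = 0 → ∫ x, x 1 * g₀ x = 0 →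
      ∀ F : EuclideanSpace ℝ (Fin 2) → ℝ, AEStronglyMeasurable F volume →
      (∃ (C : ℝ) (N : ℕ), ∀ x, |F x| ≤ C * (1 + ‖x‖) ^ N * Real.exp (-(‖x‖ ^ 2 / 4))) →
      (∀ x, g₀ x + kerWeight ‖x‖ * ∫ y, (2 * Real.pi)⁻¹ * Real.log ‖x - y‖ * g₀ y = F x) →
      Real.sqrt (∫ x, (kerWeight ‖x‖)⁻¹ * g₀ x ^ 2) ≤
        A * Real.sqrt (∫ x, (kerWeight ‖x‖)⁻¹ * F x ^ 2) := by
  obtain ⟨γ, hγ, hGS⟩ := hGS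
  refine ⟨γ⁻¹, (inv_pos.2 hγ).le, fun g₀ hg₀c hg₀g hg₀o hm₀ hm₁ F hFm hFg hF => ?_⟩
  set ψ : EuclideanSpace ℝ (Fin 2) → ℝ := fun x => ∫ y, (2 * Real.pi)⁻¹ * Real.log ‖x - y‖ * g₀ y with hψ
  have hfact : γ * ∫ x, (kerWeight ‖x‖)⁻¹ * g₀ x ^ 2 ≤
      (∫ x, (kerWeight ‖x‖)⁻¹ * g₀ x ^ 2) + ∫ x, g₀ x * ψ x := hGS g₀ hg₀c hg₀g hg₀o hm₀ hm₁
  have hF' : ∀ x, g₀ x + kerWeight ‖x‖ * ψ x = F x := hF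
  have hΦpos : ∀ x : EuclideanSpace ℝ (Fin 2), 0 < kerWeight ‖x‖ := fun x => kerWeight_pos _
  have hginv : ∀ x : EuclideanSpace ℝ (Fin 2), 0 ≤ (kerWeight ‖x‖)⁻¹ := fun x => inv_nonneg.2 (hΦpos x).le
  have hginvm : AEStronglyMeasurable (fun x : EuclideanSpace ℝ (Fin 2) => (kerWeight ‖x‖)⁻¹) volume :=
    ((continuous_kerWeight.comp continuous_norm).inv₀ fun x => (kerWeight_pos _).ne').aestronglyMeasurable
  have hg₀Φ := arnold_integrable_inv_kerWeight_mul_sq hg₀c.aestronglyMeasurable hg₀g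
  have hFΦ := arnold_integrable_inv_kerWeight_mul_sq hFm hFg
  obtain ⟨hprod, hcs⟩ := abs_integral_weight_mul_mul_le (μ := volume) hginv hginvm
    hg₀c.aestronglyMeasurable hFm hg₀Φ hFΦ
  -- the right-hand side of the fact is `∫ Φ⁻¹ g₀ F`
  have hptF : ∀ x, (kerWeight ‖x‖)⁻¹ * g₀ x ^ 2 + g₀ x * ψ x = (kerWeight ‖x‖)⁻¹ * (g₀ x * F x) := by
    intro x
    rw [← hF' x]
    have hΦ := (hΦpos x).ne'
    generalize ψ x = t
    field_simp
  have hgψ : Integrable fun x => g₀ x * ψ x := by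
    refine (hprod.sub hg₀Φ).congr (Eventually.of_forall fun x => ?_)
    simp only [Pi.sub_apply]
    linarith [hptF x]
  have hrhs : (∫ x, (kerWeight ‖x‖)⁻¹ * g₀ x ^ 2) + ∫ x, g₀ x * ψ x =
      ∫ x, (kerWeight ‖x‖)⁻¹ * (g₀ x * F x) := by
    rw [← integral_add hg₀Φ hgψ]
    exact integral_congr_ae (Eventually.of_forall hptF)
  set G : ℝ := Real.sqrt (∫ x, (kerWeight ‖x‖)⁻¹ * g₀ x ^ 2) with hG
  set Fn : ℝ := Real.sqrt (∫ x, (kerWeight ‖x‖)⁻¹ * F x ^ 2) with hFn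
  have hG0 : 0 ≤ G := Real.sqrt_nonneg _
  have hFn0 : 0 ≤ Fn := Real.sqrt_nonneg _
  have hG2 : G ^ 2 = ∫ x, (kerWeight ‖x‖)⁻¹ * g₀ x ^ 2 :=
    Real.sq_sqrt (integral_nonneg fun x => mul_nonneg (hginv x) (sq_nonneg _))
  have hkey : γ * G ^ 2 ≤ G * Fn := by
    rw [hG2]
    calc γ * ∫ x, (kerWeight ‖x‖)⁻¹ * g₀ x ^ 2
        ≤ (∫ x, (kerWeight ‖x‖)⁻¹ * g₀ x ^ 2) + ∫ x, g₀ x * ψ x := hfact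
      _ = ∫ x, (kerWeight ‖x‖)⁻¹ * (g₀ x * F x) := hrhs
      _ ≤ |∫ x, (kerWeight ‖x‖)⁻¹ * (g₀ x * F x)| := le_abs_self _
      _ ≤ G * Fn := hcs
  -- divide by `G` (or `G = 0`)
  rcases hG0.eq_or_lt with hG00 | hGpos
  · rw [← hG00]; positivity
  · have : γ * G ≤ Fn := by
      refine le_of_mul_le_mul_right ?_ hGpos
      nlinarith [hkey]
    calc G = γ⁻¹ * (γ * G) := by field_simp
      _ ≤ γ⁻¹ * Fn := mul_le_mul_of_nonneg_left this (inv_pos.2 hγ).le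


/-- **Registered tools stub `stub_oddArnoldCore`: the symmetrized density in `L²(Φ⁻¹)`.** Assume the
Gallay–Šverák fact and `0 < λ < 1`. There is `B ≥ 0` such that for all continuous Gaussian-class
`f, g` with `g` odd, `∫ x_j g = −∫ x_j f` (`j = 0, 1`) and `(I − K̃) g = K̃ f` pointwise
(`g + Φ ψ_g = −Φ ψ_f`, `ψ_a = N ∗ a`), one has `‖g‖_{L²(Φ⁻¹)} ≤ B ‖f‖_{X_λ}`. Proof: with the odd
moment basis `e₀, e₁` (`∫ x_i e_j = δ_ij`) and `m_j = ∫ x_j f`, the density `g₀ = g + m₀ e₀ + m₁ e₁`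
is odd with zero first moments and `(I − K̃) g₀ = −Φψ_f + m₀ (I − K̃) e₀ + m₁ (I − K̃) e₁ =: F`; the
fact gives `‖g₀‖ ≤ γ⁻¹ ‖F‖ ≤ γ⁻¹(√K₂ + M(D₀ + D₁)) ‖f‖_{X_λ}` (`‖Φψ_f‖ ≤ √K₂ ‖f‖_{X_λ}`,
`|m_j| ≤ M ‖f‖_{X_λ}`, `D_j = ‖(I − K̃)e_j‖`), and `‖g‖ ≤ ‖g₀‖ + |m₀| ‖e₀‖ + |m₁| ‖e₁‖`. [folklore] -/
theorem stub_oddArnoldCore : Literature.Analysis.FluidPDE.GallaySverak2021_thm25_gaussian → ∀ lam ∈ Set.Ioo (0 : ℝ) 1,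
    ∃ B : ℝ, 0 ≤ B ∧ ∀ f g : EuclideanSpace ℝ (Fin 2) → ℝ, Continuous f → Continuous g →
      (∃ (C : ℝ) (N : ℕ), ∀ x, |f x| ≤ C * (1 + ‖x‖) ^ N * Real.exp (-(‖x‖ ^ 2 / 4))) →
      (∃ (C : ℝ) (N : ℕ), ∀ x, |g x| ≤ C * (1 + ‖x‖) ^ N * Real.exp (-(‖x‖ ^ 2 / 4))) →
      (∀ x, g (-x) = -g x) →
      (∫ x : EuclideanSpace ℝ (Fin 2), x 0 * g x = -∫ x : EuclideanSpace ℝ (Fin 2), x 0 * f x) →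
      (∫ x : EuclideanSpace ℝ (Fin 2), x 1 * g x = -∫ x : EuclideanSpace ℝ (Fin 2), x 1 * f x) →
      (∀ x, g x + kerWeight ‖x‖ * (∫ y, (2 * Real.pi)⁻¹ * Real.log ‖x - y‖ * g y) =
        -(kerWeight ‖x‖ * ∫ y, (2 * Real.pi)⁻¹ * Real.log ‖x - y‖ * f y)) →
      Real.sqrt (∫ x, (kerWeight ‖x‖)⁻¹ * g x ^ 2) ≤
        B * Real.sqrt (∫ x, (gaussWeightLam lam x)⁻¹ * f x ^ 2) := by
  intro hGS lam hlam
  obtain ⟨h0, h1⟩ := hlam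
  -- constants (depending on `λ`, `γ` and the moment basis only)
  obtain ⟨A, hA, hcore⟩ := arnold_kerNorm_corrected_le hGS
  obtain ⟨K₁, hK₁, hpot⟩ := arnold_logPotential_bound h1
  obtain ⟨K₂, hK₂, hsq⟩ := arnold_integral_kerWeight_mul_logPotential_sq_le h1
  obtain ⟨e₀, e₁, he₀c, he₁c, he₀o, he₁o, he₀g, he₁g, hm00, hm10, hm01, hm11⟩ :=
    arnold_exists_momentBasis
  set N : EuclideanSpace ℝ (Fin 2) → EuclideanSpace ℝ (Fin 2) → ℝ :=
    fun x y => (2 * Real.pi)⁻¹ * Real.log ‖x - y‖ with hN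
  set ψe₀ : EuclideanSpace ℝ (Fin 2) → ℝ := fun x => ∫ y, N x y * e₀ y with hψe₀
  set ψe₁ : EuclideanSpace ℝ (Fin 2) → ℝ := fun x => ∫ y, N x y * e₁ y with hψe₁
  set D₀ : ℝ := Real.sqrt (∫ x, (kerWeight ‖x‖)⁻¹ * (e₀ x + kerWeight ‖x‖ * ψe₀ x) ^ 2) with hD₀
  set D₁ : ℝ := Real.sqrt (∫ x, (kerWeight ‖x‖)⁻¹ * (e₁ x + kerWeight ‖x‖ * ψe₁ x) ^ 2) with hD₁
  set E₀ : ℝ := Real.sqrt (∫ x, (kerWeight ‖x‖)⁻¹ * e₀ x ^ 2) with hE₀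
  set E₁ : ℝ := Real.sqrt (∫ x, (kerWeight ‖x‖)⁻¹ * e₁ x ^ 2) with hE₁
  set M : ℝ := Real.sqrt (∫ x : EuclideanSpace ℝ (Fin 2), ‖x‖ ^ 2 * gaussWeightLam lam x) with hM
  have hD₀0 : 0 ≤ D₀ := Real.sqrt_nonneg _
  have hD₁0 : 0 ≤ D₁ := Real.sqrt_nonneg _
  have hE₀0 : 0 ≤ E₀ := Real.sqrt_nonneg _
  have hE₁0 : 0 ≤ E₁ := Real.sqrt_nonneg _
  have hM0 : 0 ≤ M := Real.sqrt_nonneg _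
  refine ⟨A * (Real.sqrt K₂ + M * (D₀ + D₁)) + M * (E₀ + E₁), by positivity,
    fun f g hfc hgc hfg hgg hgo hmg0 hmg1 hrel => ?_⟩
  have hfm : AEStronglyMeasurable f volume := hfc.aestronglyMeasurable
  have hgm : AEStronglyMeasurable g volume := hgc.aestronglyMeasurable
  have hfX := arnold_integrable_inv_gaussWeightLam_mul_sq h0.le h1 hfm hfg
  have hgX := arnold_integrable_inv_gaussWeightLam_mul_sq h0.le h1 hgm hgg
  set Sf : ℝ := Real.sqrt (∫ x, (gaussWeightLam lam x)⁻¹ * f x ^ 2) with hSf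
  have hSf0 : 0 ≤ Sf := Real.sqrt_nonneg _
  -- the moments `mᵢ = ∫ xᵢ f = -∫ xᵢ g`
  set m₀ : ℝ := ∫ x : EuclideanSpace ℝ (Fin 2), x 0 * f x with hm₀
  set m₁ : ℝ := ∫ x : EuclideanSpace ℝ (Fin 2), x 1 * f x with hm₁
  have hm₀b : |m₀| ≤ M * Sf := arnold_abs_moment_le h1 hfm hfX 0
  have hm₁b : |m₁| ≤ M * Sf := arnold_abs_moment_le h1 hfm hfX 1
  -- Step A: the corrected density `g₀ = g + m₀ e₀ + m₁ e₁ ∈ 𝒳₁`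
  set g₀ : EuclideanSpace ℝ (Fin 2) → ℝ := fun x => g x + m₀ * e₀ x + m₁ * e₁ x with hg₀
  have hg₀c : Continuous g₀ := (hgc.add (continuous_const.mul he₀c)).add (continuous_const.mul he₁c)
  have hg₀g : ∃ (C : ℝ) (N : ℕ), ∀ x, |g₀ x| ≤ C * (1 + ‖x‖) ^ N * Real.exp (-(‖x‖ ^ 2 / 4)) :=
    arnold_gc_add (arnold_gc_add hgg (arnold_gc_const_mul m₀ he₀g)) (arnold_gc_const_mul m₁ he₁g)
  have hg₀o : ∀ x, g₀ (-x) = -g₀ x := fun x => by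
    simp only [hg₀, hgo, he₀o, he₁o]; ring
  have he₀i := arnold_integrable_of_gc he₀c.aestronglyMeasurable he₀g
  have he₁i := arnold_integrable_of_gc he₁c.aestronglyMeasurable he₁g
  have hgi := arnold_integrable_of_gc hgm hgg
  have hmg₀ : ∀ i : Fin 2, ∫ x : EuclideanSpace ℝ (Fin 2), x i * g₀ x =
      (∫ x : EuclideanSpace ℝ (Fin 2), x i * g x) + m₀ * (∫ x : EuclideanSpace ℝ (Fin 2), x i * e₀ x) +
        m₁ * ∫ x : EuclideanSpace ℝ (Fin 2), x i * e₁ x := by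
    intro i
    have e : (fun x : EuclideanSpace ℝ (Fin 2) => x i * g₀ x) =
        fun x => (x i * g x + m₀ * (x i * e₀ x)) + m₁ * (x i * e₁ x) := by
      funext x; simp only [hg₀]; ring
    have i1 : Integrable fun x : EuclideanSpace ℝ (Fin 2) => m₀ * (x i * e₀ x) := (he₀i.2.2 i).const_mul m₀
    have i2 : Integrable fun x : EuclideanSpace ℝ (Fin 2) => m₁ * (x i * e₁ x) := (he₁i.2.2 i).const_mul m₁
    have i3 : Integrable fun x : EuclideanSpace ℝ (Fin 2) => x i * g x + m₀ * (x i * e₀ x) := (hgi.2.2 i).add i1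
    rw [e, integral_add i3 i2, integral_add (hgi.2.2 i) i1, integral_const_mul, integral_const_mul]
  have hm₀g₀ : ∫ x : EuclideanSpace ℝ (Fin 2), x 0 * g₀ x = 0 := by
    rw [hmg₀ 0, hmg0, hm00, hm01]; ring
  have hm₁g₀ : ∫ x : EuclideanSpace ℝ (Fin 2), x 1 * g₀ x = 0 := by
    rw [hmg₀ 1, hmg1, hm10, hm11]; ring
  -- Step B: the potentials of `f`, `g`, `e₀`, `e₁`, `g₀`
  set ψf : EuclideanSpace ℝ (Fin 2) → ℝ := fun x => ∫ y, N x y * f y with hψf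
  set ψg : EuclideanSpace ℝ (Fin 2) → ℝ := fun x => ∫ y, N x y * g y with hψg
  set ψg₀ : EuclideanSpace ℝ (Fin 2) → ℝ := fun x => ∫ y, N x y * g₀ y with hψg₀
  have he₀m : AEStronglyMeasurable e₀ volume := he₀c.aestronglyMeasurable
  have he₁m : AEStronglyMeasurable e₁ volume := he₁c.aestronglyMeasurable
  have hg₀m : AEStronglyMeasurable g₀ volume := hg₀c.aestronglyMeasurable
  have he₀X := arnold_integrable_inv_gaussWeightLam_mul_sq h0.le h1 he₀m he₀g
  have he₁X := arnold_integrable_inv_gaussWeightLam_mul_sq h0.le h1 he₁m he₁g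
  have hg₀X := arnold_integrable_inv_gaussWeightLam_mul_sq h0.le h1 hg₀m hg₀g
  have hif : ∀ x, Integrable fun y => (2 * Real.pi)⁻¹ * Real.log ‖x - y‖ * f y := fun x =>
    (hpot f hfm hfX x).1
  have hig : ∀ x, Integrable fun y => (2 * Real.pi)⁻¹ * Real.log ‖x - y‖ * g y := fun x =>
    (hpot g hgm hgX x).1
  have hie₀ : ∀ x, Integrable fun y => (2 * Real.pi)⁻¹ * Real.log ‖x - y‖ * e₀ y := fun x =>
    (hpot e₀ he₀m he₀X x).1
  have hie₁ : ∀ x, Integrable fun y => (2 * Real.pi)⁻¹ * Real.log ‖x - y‖ * e₁ y := fun x =>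
    (hpot e₁ he₁m he₁X x).1
  have hψg₀split : ∀ x, ψg₀ x = ψg x + m₀ * ψe₀ x + m₁ * ψe₁ x := by
    intro x
    have i1 : Integrable fun y => (2 * Real.pi)⁻¹ * Real.log ‖x - y‖ * (m₀ * e₀ y) :=
      arnold_integrable_logKernel_mul_const_mul m₀ (hie₀ x)
    have i2 : Integrable fun y => (2 * Real.pi)⁻¹ * Real.log ‖x - y‖ * (m₁ * e₁ y) :=
      arnold_integrable_logKernel_mul_const_mul m₁ (hie₁ x)
    have i12 : Integrable fun y => (2 * Real.pi)⁻¹ * Real.log ‖x - y‖ * (g y + m₀ * e₀ y) :=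
      ((hig x).add i1).congr (Eventually.of_forall fun y => by simp only [Pi.add_apply]; ring)
    simp only [hψg₀, hψg, hψe₀, hψe₁, hN, hg₀]
    rw [arnold_logPotential_add i12 i2, arnold_logPotential_add (hig x) i1,
      arnold_logPotential_const_mul, arnold_logPotential_const_mul]
  -- Step C: `(I − K̃) g₀ = K̃ f + m₀ (I − K̃) e₀ + m₁ (I − K̃) e₁ =: F`
  set F : EuclideanSpace ℝ (Fin 2) → ℝ := fun x => -(kerWeight ‖x‖ * ψf x) +
    m₀ * (e₀ x + kerWeight ‖x‖ * ψe₀ x) + m₁ * (e₁ x + kerWeight ‖x‖ * ψe₁ x) with hFdef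
  have hFid : ∀ x, g₀ x + kerWeight ‖x‖ * ψg₀ x = F x := by
    intro x
    have hr : g x + kerWeight ‖x‖ * ψg x = -(kerWeight ‖x‖ * ψf x) := hrel x
    rw [hψg₀split x]
    simp only [hFdef, hg₀]
    linear_combination hr
  have hΦc : Continuous fun x : EuclideanSpace ℝ (Fin 2) => kerWeight ‖x‖ :=
    continuous_kerWeight.comp continuous_norm
  have hΦm : AEStronglyMeasurable (fun x : EuclideanSpace ℝ (Fin 2) => kerWeight ‖x‖) volume :=
    hΦc.aestronglyMeasurable
  have hψfm : AEStronglyMeasurable ψf volume := arnold_aestronglyMeasurable_logPotential hfm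
  have hψe₀m : AEStronglyMeasurable ψe₀ volume := arnold_aestronglyMeasurable_logPotential he₀m
  have hψe₁m : AEStronglyMeasurable ψe₁ volume := arnold_aestronglyMeasurable_logPotential he₁m
  have hB₀m : AEStronglyMeasurable (fun x => e₀ x + kerWeight ‖x‖ * ψe₀ x) volume :=
    he₀m.add (hΦm.mul hψe₀m)
  have hB₁m : AEStronglyMeasurable (fun x => e₁ x + kerWeight ‖x‖ * ψe₁ x) volume :=
    he₁m.add (hΦm.mul hψe₁m)
  have hFm : AEStronglyMeasurable F volume :=
    ((hΦm.mul hψfm).neg.add ((aestronglyMeasurable_const (b := m₀)).mul hB₀m)).add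
      ((aestronglyMeasurable_const (b := m₁)).mul hB₁m)
  -- Gaussian class of the pieces of `F`
  have hψfb : ∀ x, |ψf x| ≤ K₁ * Sf * (1 + ‖x‖) ^ 1 := fun x =>
    (hpot f hfm hfX x).2.trans_eq (by rw [hSf]; ring)
  have hψe₀b : ∀ x, |ψe₀ x| ≤ K₁ * Real.sqrt (∫ y, (gaussWeightLam lam y)⁻¹ * e₀ y ^ 2) * (1 + ‖x‖) ^ 1 :=
    fun x => (hpot e₀ he₀m he₀X x).2.trans_eq (by ring)
  have hψe₁b : ∀ x, |ψe₁ x| ≤ K₁ * Real.sqrt (∫ y, (gaussWeightLam lam y)⁻¹ * e₁ y ^ 2) * (1 + ‖x‖) ^ 1 :=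
    fun x => (hpot e₁ he₁m he₁X x).2.trans_eq (by ring)
  have hB₀g : ∃ (C : ℝ) (N : ℕ), ∀ x, |e₀ x + kerWeight ‖x‖ * ψe₀ x| ≤
      C * (1 + ‖x‖) ^ N * Real.exp (-(‖x‖ ^ 2 / 4)) := arnold_gc_add he₀g (arnold_gc_kerWeight_mul hψe₀b)
  have hB₁g : ∃ (C : ℝ) (N : ℕ), ∀ x, |e₁ x + kerWeight ‖x‖ * ψe₁ x| ≤
      C * (1 + ‖x‖) ^ N * Real.exp (-(‖x‖ ^ 2 / 4)) := arnold_gc_add he₁g (arnold_gc_kerWeight_mul hψe₁b)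
  have hFg : ∃ (C : ℝ) (N : ℕ), ∀ x, |F x| ≤ C * (1 + ‖x‖) ^ N * Real.exp (-(‖x‖ ^ 2 / 4)) :=
    arnold_gc_add (arnold_gc_add (arnold_gc_neg (arnold_gc_kerWeight_mul hψfb))
      (arnold_gc_const_mul m₀ hB₀g)) (arnold_gc_const_mul m₁ hB₁g)
  -- Step D: the Gallay–Šverák coercivity on `g₀`: `‖g₀‖_Φ ≤ A ‖F‖_Φ`
  have hcoer := hcore g₀ hg₀c hg₀g hg₀o hm₀g₀ hm₁g₀ F hFm hFg hFid
  -- Step E: `‖F‖_Φ ≤ √K₂ ‖f‖_λ + |m₀| D₀ + |m₁| D₁`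
  have hΦpos : ∀ x : EuclideanSpace ℝ (Fin 2), 0 < kerWeight ‖x‖ := fun x => kerWeight_pos _
  have hginv : ∀ x : EuclideanSpace ℝ (Fin 2), 0 ≤ (kerWeight ‖x‖)⁻¹ := fun x => inv_nonneg.2 (hΦpos x).le
  have hginvm : AEStronglyMeasurable (fun x : EuclideanSpace ℝ (Fin 2) => (kerWeight ‖x‖)⁻¹) volume :=
    (hΦc.inv₀ fun x => (kerWeight_pos _).ne').aestronglyMeasurable
  obtain ⟨hKf, hKfle⟩ := hsq f ψf hfm hfX (fun x => rfl)
  have ha : Integrable fun x => (kerWeight ‖x‖)⁻¹ * (-(kerWeight ‖x‖ * ψf x)) ^ 2 :=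
    hKf.congr (Eventually.of_forall fun x => by simp only [neg_sq])
  have hb : Integrable fun x => (kerWeight ‖x‖)⁻¹ * (m₀ * (e₀ x + kerWeight ‖x‖ * ψe₀ x)) ^ 2 :=
    arnold_integrable_inv_kerWeight_mul_sq ((aestronglyMeasurable_const (b := m₀)).mul hB₀m)
      (arnold_gc_const_mul m₀ hB₀g)
  have hc : Integrable fun x => (kerWeight ‖x‖)⁻¹ * (m₁ * (e₁ x + kerWeight ‖x‖ * ψe₁ x)) ^ 2 :=
    arnold_integrable_inv_kerWeight_mul_sq ((aestronglyMeasurable_const (b := m₁)).mul hB₁m)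
      (arnold_gc_const_mul m₁ hB₁g)
  obtain ⟨-, hMinkF⟩ := arnold_sqrt_integral_weight_mul_add_add_sq_le (μ := volume)
    (a := fun x => -(kerWeight ‖x‖ * ψf x)) (b := fun x => m₀ * (e₀ x + kerWeight ‖x‖ * ψe₀ x))
    (c := fun x => m₁ * (e₁ x + kerWeight ‖x‖ * ψe₁ x)) hginv hginvm
    (hΦm.mul hψfm).neg ((aestronglyMeasurable_const (b := m₀)).mul hB₀m)
    ((aestronglyMeasurable_const (b := m₁)).mul hB₁m) ha hb hc
  have hFn : Real.sqrt (∫ x, (kerWeight ‖x‖)⁻¹ * F x ^ 2) ≤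
      Real.sqrt K₂ * Sf + M * Sf * D₀ + M * Sf * D₁ := by
    refine hMinkF.trans ?_
    have t1 : Real.sqrt (∫ x, (kerWeight ‖x‖)⁻¹ * (-(kerWeight ‖x‖ * ψf x)) ^ 2) ≤ Real.sqrt K₂ * Sf := by
      have e : ∫ x, (kerWeight ‖x‖)⁻¹ * (-(kerWeight ‖x‖ * ψf x)) ^ 2 =
          ∫ x, (kerWeight ‖x‖)⁻¹ * (kerWeight ‖x‖ * ψf x) ^ 2 :=
        integral_congr_ae (Eventually.of_forall fun x => by simp only [neg_sq])
      rw [e, hSf, ← Real.sqrt_mul hK₂.le]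
      exact Real.sqrt_le_sqrt hKfle
    have t2 : Real.sqrt (∫ x, (kerWeight ‖x‖)⁻¹ * (m₀ * (e₀ x + kerWeight ‖x‖ * ψe₀ x)) ^ 2) ≤ M * Sf * D₀ := by
      rw [arnold_sqrt_integral_weight_mul_const_mul_sq, ← hD₀]
      exact mul_le_mul_of_nonneg_right hm₀b hD₀0
    have t3 : Real.sqrt (∫ x, (kerWeight ‖x‖)⁻¹ * (m₁ * (e₁ x + kerWeight ‖x‖ * ψe₁ x)) ^ 2) ≤ M * Sf * D₁ := by
      rw [arnold_sqrt_integral_weight_mul_const_mul_sq, ← hD₁]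
      exact mul_le_mul_of_nonneg_right hm₁b hD₁0
    linarith
  -- Step F: `‖g‖_Φ ≤ ‖g₀‖_Φ + |m₀| E₀ + |m₁| E₁`
  have hg₀Φ := arnold_integrable_inv_kerWeight_mul_sq hg₀m hg₀g
  have hb' : Integrable fun x => (kerWeight ‖x‖)⁻¹ * (-m₀ * e₀ x) ^ 2 :=
    arnold_integrable_inv_kerWeight_mul_sq ((aestronglyMeasurable_const (b := -m₀)).mul he₀m)
      (arnold_gc_const_mul (-m₀) he₀g)
  have hc' : Integrable fun x => (kerWeight ‖x‖)⁻¹ * (-m₁ * e₁ x) ^ 2 :=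
    arnold_integrable_inv_kerWeight_mul_sq ((aestronglyMeasurable_const (b := -m₁)).mul he₁m)
      (arnold_gc_const_mul (-m₁) he₁g)
  obtain ⟨-, hMinkg⟩ := arnold_sqrt_integral_weight_mul_add_add_sq_le (μ := volume)
    (a := g₀) (b := fun x => -m₀ * e₀ x) (c := fun x => -m₁ * e₁ x) hginv hginvm
    hg₀m ((aestronglyMeasurable_const (b := -m₀)).mul he₀m)
    ((aestronglyMeasurable_const (b := -m₁)).mul he₁m) hg₀Φ hb' hc'
  have hgn : Real.sqrt (∫ x, (kerWeight ‖x‖)⁻¹ * g x ^ 2) ≤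
      A * Real.sqrt (∫ x, (kerWeight ‖x‖)⁻¹ * F x ^ 2) + M * Sf * E₀ + M * Sf * E₁ := by
    have e : ∫ x, (kerWeight ‖x‖)⁻¹ * g x ^ 2 =
        ∫ x, (kerWeight ‖x‖)⁻¹ * (g₀ x + -m₀ * e₀ x + -m₁ * e₁ x) ^ 2 :=
      integral_congr_ae (Eventually.of_forall fun x => by simp only [hg₀]; ring)
    rw [e]
    refine hMinkg.trans ?_
    rw [arnold_sqrt_integral_weight_mul_const_mul_sq, arnold_sqrt_integral_weight_mul_const_mul_sq,
      ← hE₀, ← hE₁, abs_neg, abs_neg]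
    have t2 := mul_le_mul_of_nonneg_right hm₀b hE₀0
    have t3 := mul_le_mul_of_nonneg_right hm₁b hE₁0
    linarith
  -- bookkeeping
  have u1 := mul_le_mul_of_nonneg_left hFn hA
  calc Real.sqrt (∫ x, (kerWeight ‖x‖)⁻¹ * g x ^ 2)
      ≤ A * (Real.sqrt K₂ * Sf + M * Sf * D₀ + M * Sf * D₁) + M * Sf * E₀ + M * Sf * E₁ := by linarith
    _ = (A * (Real.sqrt K₂ + M * (D₀ + D₁)) + M * (E₀ + E₁)) * Sf := by ring

end Summit.NavierStokesRegularity.NavierStokesRegularity.Theorems
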